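import Literature.Analysis.FluidPDE.KNSSLiouville
import HarnessLib

/-!
# Local axisymmetric regularity theory of Seregin–Šverák (2009): the architecture of Theorem 3.1

G. Seregin, V. Šverák, *On Type I singularities of the local axi-symmetric solutions of the
Navier–Stokes equations*, Comm. PDE 34 (2009), 171–201 = arXiv:0804.1803 (page and label
references below are to the arXiv version), prove (Thm. 3.1 = Thm. 1.1) that the space–time
origin is a regular point of every axially symmetric distributional solution `(v, q)`,
`v ∈ L³(Q)`, `q ∈ L^{3/2}(Q)`, of the Navier–Stokes system (`ν = 1`) in the unit cylinder
`Q = 𝒞 × ]-1, 0[` obeying the Type I bound `|v(x,t)| ≤ C/√(-t)` a.e. in `Q`. The statement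
itself is catalogued as the barrier fact
`Literature.Barriers.NavierStokesRegularity.AxisymmetricTypeIExclusion`; this file vendors the
vocabulary of §3 and the intermediate results of the printed proof as named facts, and PROVES
the top-level assembly of §4 from them and from the Liouville theorem of
Koch–Nadirashvili–Seregin–Šverák (KNSS 2009, Thm. 5.3, the accepted named fact
`Literature.Analysis.FluidPDE.KNSS2009_liouville_bound_C_over_r`).

## The printed proof (arXiv:0804.1803, §3–§4)

* §3, p. 9: the setting — `Q = 𝒞 × ]-1,0[`, `𝒞 = {|x'| < 1, |x₃| < 1}`, `𝒞(x₀, R)`, `Q(z₀, R) =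
  𝒞(x₀, R) × ]t₀ - R², t₀[`, "`v` is regular at `z = 0` if there exists `r > 0` such that `v` is
  essentially bounded in `Q(r)`", and the scale-invariant functionals
  `A(z₀,r;v) = esssup_{t₀-r²<t<t₀} r⁻¹ ∫_{𝒞(x₀,r)} |v|²`, `E(z₀,r;v) = r⁻¹ ∫_{Q(z₀,r)} |∇v|²`,
  `C(z₀,r;v) = r⁻² ∫_{Q(z₀,r)} |v|³`, `D(z₀,r;q) = r⁻² ∫_{Q(z₀,r)} |q|^{3/2}`.
* Lemma 3.3 (`L_∞` bound on the swirl `ϱ v_φ`, App. II) and Remark 3.4: under the standing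
  assumptions, axial symmetry and `v ∈ L_∞(𝒞 × ]-1,-a²[)` for every `0 < a < 1` (their (r2)),
  `(v, q)` is a suitable weak solution in `Q`.
* Lemma 3.5: under the hypotheses of Thm. 3.1, `A + E + C + D ≤ C₁` at all `z_b = (b e₃, 0)`,
  `|b| ≤ 1/4`, `0 < r < 1/4` (bootstrap of the local energy inequality with the multiplicative
  inequality (as2) of [S10] and the pressure decay estimate (as13)).
* Proposition 3.7: under the hypotheses of Thm. 3.1, `|v(x,t)| ≤ C₁/|x'|` on `Q(1/8)` (ε-regularity
  off the axis, [S11], fed by Lemma 3.5).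
* §4, p. 11 (proof of Thms. 3.1 and 3.2): "using Lemmata 3.3, 3.5, 3.6, Remark 3.4,
  Proposition 3.7 and scaling arguments" one may assume (p1) `sup_{0<r≤1} (A+E+C+D)(0,r) < ∞` and
  (p2) `sup_Q |x'||v| < ∞`; if `z = 0` were singular, rescaling `u^k(y,s) = λ_k v(λ_k y',
  x_{3k} + λ_k y₃, t_k + λ_k² s)`, `λ_k = 1/M_k → 0`, around running maxima and passing to the
  limit ((p3)–(p11), local `L_p` theory of the Stokes system) produces a bounded ancient (weak)
  solution `u` on `ℝ³ × ]-∞, 0[` (their Def. 2.3 = KNSS's bounded weak solutions), axially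
  symmetric, with `sup |y'||u(y,s)| ≤ A₂` and `|u(y'_*, 0, 0)| = 1`, `u ∈ C^{1/4}` up to `s = 0` —
  in particular not identically zero; "as it was shown in [KNSS], such a solution must be
  identically zero" (KNSS 2009, Thm. 5.3), a contradiction.

## Contents

* `SereginSverak2009.spaceCyl x₀ R`, `SereginSverak2009.parCyl z₀ R` (+ `parCylOpens`): the
  cylinders `𝒞(x₀, R)` and `Q(z₀, R)` (time first, as everywhere in the tree);
* `SereginSverak2009.energyA / dissipationE / cubicC / pressureD`: the functionals `A, E, C, D`
  of §3 (`ℝ≥0∞`-valued; `E` through a weak spatial gradient `G` standing for `∇v`);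
* `SereginSverak2009.IsAxisymmetricLocalSolution u p`: the standing assumptions of §3 plus axial
  symmetry; `SereginSverak2009.IsRegularAtOrigin u`: the printed notion of regular point;
* named facts: `SereginSverak2009.SuitableOfBounded` (Remark 3.4),
  `SereginSverak2009.ScaledEnergyBound` (Lemma 3.5), `SereginSverak2009.AxisDecayBound`
  (Prop. 3.7), `SereginSverak2009.BlowupAlternative` (§4, the blow-up step before KNSS is
  invoked);
* proved: `SereginSverak2009.isRegularAtOrigin_of_typeI` — Thm. 3.1 in the notation of §3,
  from `ScaledEnergyBound`, `AxisDecayBound`, `BlowupAlternative` and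
  `KNSS2009_liouville_bound_C_over_r`, following the last two sentences of §4 (see the caveat on
  `BlowupAlternative` below); and the bookkeeping lemma
  `SereginSverak2009.isBoundedAwayFromZero_of_isTypeIOnCyl` ((r3) ⇒ (r2)).

## Rendering choices

* Axial symmetry of the `L³` field `v` is rendered, as in the barrier file, by POINTWISE
  axisymmetry of every slice `u t`, `-1 < t < 0` (`IsAxisymmetric`), a stronger hypothesis than
  the distributional one, so every fact below is implied by its printed form.
* "`|v(x,t)| ≤ C₁/|x'|` for all `z ∈ Q(1/8)`" (Prop. 3.7, stated for the Hölder continuous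
  representative) and the outputs of §4 are rendered almost everywhere / in the a.e. forms
  consumed by `KNSS2009_liouville_bound_C_over_r` (weaker conclusions). The uniform dependence
  of the constants on `C`, `‖v‖_{L³(Q)}`, `‖q‖_{L^{3/2}(Q)}` printed in Lemma 3.5 and Prop. 3.7
  is dropped (weaker conclusions).
* Lemma 3.5's estimate presupposes `∇v ∈ L²_loc(Q)` (Remark 3.4); the fact provides the weak
  spatial gradient `G` (`HasWeakSpatialGradientOn`, accepted) through which `E` is computed.
* `BlowupAlternative` is §4 read from its first sentence: its hypotheses are the standing
  assumptions, axial symmetry, (r2) (which is hypothesis of Thm. 3.2 and follows from (r3) for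
  Thm. 3.1, `isBoundedAwayFromZero_of_isTypeIOnCyl`), and the LOCAL forms of (p1), (p2) as
  printed — (p1) centred at the origin only — with the blow-up limit as conclusion. CAVEAT
  (found after landing; `SereginSverakBlowup.lean`, module docstring): step (iv) of §4 consumes
  `A, E, C, D` at the MOVING blow-up centres `(x_{3k} e₃, t_k)`, which the origin-centred (p1)
  does not control; `BlowupAlternative` is a true statement (after a zoom its hypotheses contain
  those of Thm. 3.2), and its discharge is the blow-up step run under the hypotheses of Thm. 3.2,
  the moving-centre bounds coming from Lemma 3.6 WITH its uniformity applied to time-shifted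
  zooms (`blowupAlternative_of_facts : ScaledEnergyBound36 → InteriorContinuity →
  BlowupCompactness → BlowupAlternative`, `SereginSverakBlowupDecay.lean`). For Thm. 3.1 the
  rendering `BlowupAlternativeTypeI` (`SereginSverakBlowup.lean`: Type I plus the full printed
  output of Lemma 3.5, assembly `isRegularAtOrigin_of_typeI'`) gets the moving-centre bounds inside
  one solution; Thm. 3.2 is assembled from Lemma 3.6 at the origin, `BlowupAlternative` and
  KNSS 2009, Thm. 5.3 (`isRegularAtOrigin_of_axisDecay`, `SereginSverakAxisDecay.lean`). The
  functionals carry the documented junk value `(ENNReal.ofReal r)⁻¹ = ∞` for `r ≤ 0` and are only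
  used at `r > 0`.
* Not here: Lemma 3.3 / App. II (the Moser iteration for `ϱ v_φ`), Lemma 3.6 and Thm. 3.2,
  Thm. 1.3, Thm. 2.4 and Thm. 2.8 (the general first-singular-time blow-up to a MILD bounded
  ancient solution), and the multiplicative inequality (as2) of [S10].

## References

* G. Seregin, V. Šverák, Comm. PDE 34 (2009), 171–201, arXiv:0804.1803: §3 (p. 9: setting,
  Thm. 3.1 (rt1), Thm. 3.2, Lemma 3.3 (asl2), Remark 3.4 (asr3), functionals, Lemma 3.5 (asl4),
  (as4)–(as5); p. 10: Prop. 3.7 (asp6), (as14)), §4 (p. 11, (p1)–(p11)). [`SereginSverak2009`]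
* G. Koch, N. Nadirashvili, G. Seregin, V. Šverák, Acta Math. 203 (2009), 83–105,
  arXiv:0709.3599, Thm. 5.3. [`KochNadirashviliSereginSverak2009`]
-/

noncomputable section

open MeasureTheory Set Function Filter Topology TopologicalSpace
open scoped NNReal ENNReal

namespace Literature.Analysis.FluidPDE

namespace SereginSverak2009

/-- Local notation for physical space `ℝ³ = EuclideanSpace ℝ (Fin 3)`. -/
local notation "ℝ³" => EuclideanSpace ℝ (Fin 3)

/-! ### The cylinders of §3 -/

/-- The spatial cylinder `𝒞(x₀, R) = {x = (x', x₃) : |x' - x₀'| < R, |x₃ - x₀₃| < R}` of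
Seregin–Šverák 2009, §3 (arXiv p. 9); `|x' - x₀'|` is `cylRadius (x - x₀)`. Empty for `R ≤ 0`.
[cite: SereginSverak2009, §3 (notation before Lemma 3.5, arXiv p. 9)] -/
def spaceCyl (x₀ : ℝ³) (R : ℝ) : Set ℝ³ :=
  {x | cylRadius (x - x₀) < R ∧ |x 2 - x₀ 2| < R}

/-- The parabolic cylinder `Q(z₀, R) = 𝒞(x₀, R) × ]t₀ - R², t₀[` of Seregin–Šverák 2009, §3
(arXiv p. 9), for `z₀ = (t₀, x₀)` written time first; `Q = Q(0, 1) = 𝒞 × ]-1, 0[` is the unit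
cylinder of Thm. 3.1 and `Q(r) = Q(0, r)`. [cite: SereginSverak2009, §3 (notation before Lemma 3.5, arXiv p. 9)] -/
def parCyl (z₀ : ℝ × ℝ³) (R : ℝ) : Set (ℝ × ℝ³) :=
  {z | z.1 ∈ Ioo (z₀.1 - R ^ 2) z₀.1 ∧ z.2 ∈ spaceCyl z₀.2 R}

/-- Membership in `𝒞(x₀, R)`, unfolded. [cite: SereginSverak2009, §3 (arXiv p. 9)] -/
theorem mem_spaceCyl {x₀ x : ℝ³} {R : ℝ} :
    x ∈ spaceCyl x₀ R ↔ cylRadius (x - x₀) < R ∧ |x 2 - x₀ 2| < R :=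
  Iff.rfl

/-- Membership in `Q(z₀, R)`, unfolded. [cite: SereginSverak2009, §3 (arXiv p. 9)] -/
theorem mem_parCyl {z₀ z : ℝ × ℝ³} {R : ℝ} :
    z ∈ parCyl z₀ R ↔ z.1 ∈ Ioo (z₀.1 - R ^ 2) z₀.1 ∧ cylRadius (z.2 - z₀.2) < R ∧ |z.2 2 - z₀.2 2| < R :=
  Iff.rfl

/-- Membership in the unit cylinder `Q = Q(0, 1) = 𝒞 × ]-1, 0[`: `-1 < t < 0`, `|x'| < 1`,
`|x₃| < 1`. [cite: SereginSverak2009, §3 (arXiv p. 9)] -/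
@[simp]
theorem mem_parCyl_zero {z : ℝ × ℝ³} {R : ℝ} :
    z ∈ parCyl 0 R ↔ z.1 ∈ Ioo (-R ^ 2) 0 ∧ cylRadius z.2 < R ∧ |z.2 2| < R := by
  simp [mem_parCyl]

/-- The spatial cylinders are open. [folklore] -/
theorem isOpen_spaceCyl (x₀ : ℝ³) (R : ℝ) : IsOpen (spaceCyl x₀ R) := by
  have h1 : Continuous fun x : ℝ³ => cylRadius (x - x₀) := continuous_cylRadius.comp (by fun_prop)
  have h2 : Continuous fun x : ℝ³ => |x 2 - x₀ 2| := by fun_prop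
  exact (isOpen_lt h1 continuous_const).inter (isOpen_lt h2 continuous_const)

/-- The parabolic cylinders are open. [folklore] -/
theorem isOpen_parCyl (z₀ : ℝ × ℝ³) (R : ℝ) : IsOpen (parCyl z₀ R) :=
  (isOpen_Ioo.preimage continuous_fst).inter ((isOpen_spaceCyl z₀.2 R).preimage continuous_snd)

/-- `Q(z₀, R)` as an element of `Opens (ℝ × ℝ³)`, the domain type of the accepted
`IsDistributionalNSSolutionOn`. [cite: SereginSverak2009, §3 (arXiv p. 9)] -/
def parCylOpens (z₀ : ℝ × ℝ³) (R : ℝ) : Opens (ℝ × ℝ³) :=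
  ⟨parCyl z₀ R, isOpen_parCyl z₀ R⟩

/-- Underlying set of `parCylOpens`. [folklore] -/
@[simp]
theorem coe_parCylOpens (z₀ : ℝ × ℝ³) (R : ℝ) :
    ((parCylOpens z₀ R : Opens (ℝ × ℝ³)) : Set (ℝ × ℝ³)) = parCyl z₀ R :=
  rfl

/-- The parabolic cylinders about a fixed centre increase with the radius (`0 ≤ R ≤ R'`).
[folklore] -/
theorem parCyl_mono (z₀ : ℝ × ℝ³) {R R' : ℝ} (hR : 0 ≤ R) (h : R ≤ R') :
    parCyl z₀ R ⊆ parCyl z₀ R' := by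
  intro z hz
  rw [mem_parCyl] at hz ⊢
  have h2 : R ^ 2 ≤ R' ^ 2 := pow_le_pow_left₀ hR h 2
  exact ⟨⟨by linarith [hz.1.1], hz.1.2⟩, hz.2.1.trans_le h, hz.2.2.trans_le h⟩

/-! ### The scale-invariant functionals of §3 -/

/-- `A(z₀, r; v) = esssup_{t₀ - r² < t < t₀} r⁻¹ ∫_{𝒞(x₀, r)} |v(x, t)|² dx` (Seregin–Šverák 2009,
§3, arXiv p. 9), in `ℝ≥0∞`, the essential supremum taken for Lebesgue measure on
`]t₀ - r², t₀[`. Intended for `r > 0` (`(ENNReal.ofReal r)⁻¹ = ∞` for `r ≤ 0`, junk).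
[cite: SereginSverak2009, §3 (definition of A, arXiv p. 9)] -/
def energyA (z₀ : ℝ × ℝ³) (r : ℝ) (u : ℝ → ℝ³ → ℝ³) : ℝ≥0∞ :=
  essSup (fun t : ℝ => (ENNReal.ofReal r)⁻¹ * ∫⁻ x in spaceCyl z₀.2 r, ‖u t x‖ₑ ^ 2)
    (volume.restrict (Ioo (z₀.1 - r ^ 2) z₀.1))

/-- `E(z₀, r; v) = r⁻¹ ∫_{Q(z₀, r)} |∇v|² dz` (Seregin–Šverák 2009, §3, arXiv p. 9), in `ℝ≥0∞`,
with `G` standing for the (weak) spatial gradient `∇v` and `|∇v|²` its squared Frobenius norm.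
Intended for `r > 0`. [cite: SereginSverak2009, §3 (definition of E, arXiv p. 9)] -/
def dissipationE (z₀ : ℝ × ℝ³) (r : ℝ) (G : ℝ → ℝ³ → ℝ³ →L[ℝ] ℝ³) : ℝ≥0∞ :=
  (ENNReal.ofReal r)⁻¹ * ∫⁻ z in parCyl z₀ r, ENNReal.ofReal (frobeniusNormSq (G z.1 z.2))

/-- `C(z₀, r; v) = r⁻² ∫_{Q(z₀, r)} |v|³ dz` (Seregin–Šverák 2009, §3, arXiv p. 9), in `ℝ≥0∞`.
Intended for `r > 0`. [cite: SereginSverak2009, §3 (definition of C, arXiv p. 9)] -/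
def cubicC (z₀ : ℝ × ℝ³) (r : ℝ) (u : ℝ → ℝ³ → ℝ³) : ℝ≥0∞ :=
  (ENNReal.ofReal r ^ 2)⁻¹ * ∫⁻ z in parCyl z₀ r, ‖u z.1 z.2‖ₑ ^ (3 : ℕ)

/-- `D(z₀, r; q) = r⁻² ∫_{Q(z₀, r)} |q|^{3/2} dz` (Seregin–Šverák 2009, §3, arXiv p. 9; no mean is
subtracted), in `ℝ≥0∞`. Intended for `r > 0`. [cite: SereginSverak2009, §3 (definition of D, arXiv p. 9)] -/
def pressureD (z₀ : ℝ × ℝ³) (r : ℝ) (p : ℝ → ℝ³ → ℝ) : ℝ≥0∞ :=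
  (ENNReal.ofReal r ^ 2)⁻¹ * ∫⁻ z in parCyl z₀ r, ‖p z.1 z.2‖ₑ ^ (3 / 2 : ℝ)

/-! ### Standing assumptions, regular points -/

/-- **The standing assumptions of §3 plus axial symmetry** (Seregin–Šverák 2009, §3, arXiv p. 9,
and the hypotheses common to Thms. 3.1–3.2): `(u, p)` solves the Navier–Stokes system (`ν = 1`,
no force) in the sense of distributions in `Q = 𝒞 × ]-1, 0[` (accepted
`IsDistributionalNSSolutionOn` on `parCylOpens 0 1`), `u ∈ L³(Q)`, `p ∈ L^{3/2}(Q)`, and every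
slice `u t`, `-1 < t < 0`, is axisymmetric about the `x₃`-axis (pointwise; see the module
docstring). [cite: SereginSverak2009, §3 (arXiv p. 9) and Thm. 3.1] -/
structure IsAxisymmetricLocalSolution (u : ℝ → ℝ³ → ℝ³) (p : ℝ → ℝ³ → ℝ) : Prop where
  /-- Navier–Stokes in the sense of distributions in `Q`. -/
  distributional : IsDistributionalNSSolutionOn (parCylOpens 0 1) 1 0 u p
  /-- `u ∈ L³(Q)`. -/
  velocity_L3 : ∫⁻ z in parCyl 0 1, ‖u z.1 z.2‖ₑ ^ (3 : ℕ) < ∞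
  /-- `p ∈ L^{3/2}(Q)`. -/
  pressure_L32 : ∫⁻ z in parCyl 0 1, ‖p z.1 z.2‖ₑ ^ (3 / 2 : ℝ) < ∞
  /-- every slice is axisymmetric about the `x₃`-axis. -/
  axisymmetric : ∀ t ∈ Ioo (-1 : ℝ) 0, IsAxisymmetric (u t)

/-- **Regularity of the origin** (Seregin–Šverák 2009, §3, arXiv p. 9: "the velocity `v` is
regular at the point `z = 0` if there exists a positive number `r` such that `v` is essentially
bounded in the space-time cylinder `Q(r)`"): `u ∈ L^∞(Q(0, r))` for some `r > 0`.
[cite: SereginSverak2009, §3 (definition of regular point, arXiv p. 9)] -/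
def IsRegularAtOrigin (u : ℝ → ℝ³ → ℝ³) : Prop :=
  ∃ r > 0, eLpNorm (uncurry u) ∞ (volume.restrict (parCyl 0 r)) < ∞

/-- The Type I hypothesis (r3) of Thm. 3.1, `|v(x,t)| ≤ C/√(-t)` for a.e. `z = (x,t) ∈ Q`, in the
junk-free form `√(-t) ‖u(t,x)‖ ≤ C` a.e. on `Q`. [cite: SereginSverak2009, Thm. 3.1 (r3)] -/
def IsTypeIOnCyl (u : ℝ → ℝ³ → ℝ³) : Prop :=
  ∃ C : ℝ, ∀ᵐ z ∂(volume.restrict (parCyl 0 1)), Real.sqrt (-z.1) * ‖u z.1 z.2‖ ≤ C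

/-- Hypothesis (r2) of Lemma 3.3 / Thm. 3.2: `v ∈ L_∞(𝒞 × ]-1, -a²[)` for each `0 < a < 1`
(Seregin–Šverák 2009, arXiv p. 9), as an a.e. bound on `Q ∩ {t < -a²}`.
[cite: SereginSverak2009, Lemma 3.3 and Thm. 3.2, (r2)] -/
def IsBoundedAwayFromZero (u : ℝ → ℝ³ → ℝ³) : Prop :=
  ∀ a ∈ Ioo (0 : ℝ) 1, ∃ K : ℝ, ∀ᵐ z ∂(volume.restrict (parCyl 0 1)), z.1 < -a ^ 2 → ‖u z.1 z.2‖ ≤ K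

/-! ### The intermediate results of the printed proof, as named facts -/

/-- **Seregin–Šverák 2009, Remark 3.4** (arXiv p. 9: "Under the assumptions of Lemma 3.3, the
pair `v` and `q` forms a suitable weak solution to the Navier–Stokes equations in `Q`"). The
assumptions of Lemma 3.3 are the standing ones, axial symmetry and (r2). The conclusion is
rendered by the accepted LOCAL notion `IsSuitableWeakSolutionOn` (CKN 1982 / Lin 1998: local
classes and the local energy inequality for `φ ∈ C_c^∞(Q)`), which the printed Def. 2.2
(global classes `L_{2,∞}(Q) ∩ W^{1,0}_2(Q)`) implies. [cite: SereginSverak2009, Remark 3.4] -/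
def SuitableOfBounded : Prop :=
  ∀ (u : ℝ → ℝ³ → ℝ³) (p : ℝ → ℝ³ → ℝ), IsAxisymmetricLocalSolution u p →
    IsBoundedAwayFromZero u → IsSuitableWeakSolutionOn (parCylOpens 0 1) 1 0 u p

/-- **Seregin–Šverák 2009, Lemma 3.5** (arXiv p. 9: "Under assumptions of Theorem 3.1, we have the
estimate `A(z_b,r;v) + E(z_b,r;v) + C(z_b,r;v) + D(z_b,r;q) ≤ C₁ < +∞` for all
`z_b = (b e₃, 0)`, `b ∈ ℝ`, `|b| ≤ 1/4`, `0 < r < 1/4`", with `C₁` depending only on `C`,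
`‖v‖_{L³(Q)}`, `‖q‖_{L^{3/2}(Q)}`). Rendered with the weak spatial gradient `G = ∇v ∈ L²_loc(Q)`
(Remark 3.4) through which `E` is computed, and without the uniformity of `C₁` (module
docstring). [cite: SereginSverak2009, Lemma 3.5 with Remark 3.4] -/
def ScaledEnergyBound : Prop :=
  ∀ (u : ℝ → ℝ³ → ℝ³) (p : ℝ → ℝ³ → ℝ), IsAxisymmetricLocalSolution u p → IsTypeIOnCyl u →
    ∃ G : ℝ → ℝ³ → ℝ³ →L[ℝ] ℝ³, HasWeakSpatialGradientOn (parCylOpens 0 1) u G ∧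
      ∃ C₁ : ℝ≥0, ∀ b : ℝ, |b| ≤ 1 / 4 → ∀ r ∈ Ioo (0 : ℝ) (1 / 4),
        energyA ((0 : ℝ), b • eZ) r u + dissipationE ((0 : ℝ), b • eZ) r G +
          cubicC ((0 : ℝ), b • eZ) r u + pressureD ((0 : ℝ), b • eZ) r p ≤ C₁

/-- **Seregin–Šverák 2009, Proposition 3.7** (arXiv p. 10: "Assume that all conditions of
Theorem 3.1 hold. Then `|v(x,t)| ≤ C₁/|x'|` for all `z = (x,t) ∈ Q(1/8)`", `C₁` depending only on
`C`, `‖v‖_{L³(Q)}`, `‖q‖_{L^{3/2}(Q)}`; printed for the Hölder continuous representative).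
Rendered almost everywhere on `Q(1/8)` in the junk-free form `|x'| ‖u‖ ≤ C₁`.
[cite: SereginSverak2009, Prop. 3.7] -/
def AxisDecayBound : Prop :=
  ∀ (u : ℝ → ℝ³ → ℝ³) (p : ℝ → ℝ³ → ℝ), IsAxisymmetricLocalSolution u p → IsTypeIOnCyl u →
    ∃ C₁ : ℝ, ∀ᵐ z ∂(volume.restrict (parCyl 0 (1 / 8))), cylRadius z.2 * ‖u z.1 z.2‖ ≤ C₁

/-- **Seregin–Šverák 2009, §4, the blow-up step of the proof of Theorems 3.1–3.2** (arXiv p. 11,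
(p1)–(p11), read from its opening sentence "Using Lemmata 3.3, 3.5, 3.6, Remark 3.4,
Proposition 3.7 and scaling arguments, we may assume (p1), (p2)"). Let `(u, p)` satisfy the
standing assumptions with axial symmetry and (r2), and suppose that near the origin the scaled
functionals are bounded — `sup_{0<r≤ρ} (A + E + C + D)(0, r) < ∞` for some `ρ ∈ ]0, 1]`, `E`
through a weak spatial gradient `G = ∇u` on `Q` (local (p1), the output of Lemma 3.5 / 3.6) — and
`|x'| ‖u‖ ≤ A₂` a.e. on some `Q(ρ)` (local (p2), the output of Prop. 3.7 / hypothesis (r4)). If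
`z = 0` is NOT a regular point, the rescaling `u^k(y,s) = λ_k u(λ_k y', x_{3k} + λ_k y₃,
t_k + λ_k² s)` around running maxima converges ((p3)–(p11)) to a bounded ancient solution on
`ℝ³ × ]-∞, 0[` in the sense of their Def. 2.3 — a bounded weak solution in the class of KNSS
(accepted `IsBoundedWeakNSSolutionOn (Iio 0)`), axially symmetric, with `|y'| ‖w‖ ≤ A₂` ((p10))
and `|w(y'_*, 0, 0)| = 1`, `w` Hölder continuous up to `s = 0` ((p11)) — recorded in the a.e.
forms consumed by `KNSS2009_liouville_bound_C_over_r`: `w` is not a.e. zero. The last sentence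
of §4 (KNSS 2009, Thm. 5.3 kills `w`) is NOT part of this fact. CAVEAT (module docstring): the
origin-centred (p1), as printed, does not control the moving blow-up centres used in step (iv);
the statement is true, its discharge being the blow-up step under the hypotheses of Thm. 3.2 with
the uniform Lemma 3.6 (`blowupAlternative_of_facts`, `SereginSverakBlowupDecay.lean`); under the
Type I bound `BlowupAlternativeTypeI` (`SereginSverakBlowup.lean`) is the blow-up step whose
moving-centre bounds come from Lemma 3.5 inside one solution.
[cite: SereginSverak2009, §4 (proof of Thms. 3.1–3.2, (p1)–(p11), arXiv p. 11)] -/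
def BlowupAlternative : Prop :=
  ∀ (u : ℝ → ℝ³ → ℝ³) (p : ℝ → ℝ³ → ℝ), IsAxisymmetricLocalSolution u p →
    IsBoundedAwayFromZero u →
    (∃ G : ℝ → ℝ³ → ℝ³ →L[ℝ] ℝ³, HasWeakSpatialGradientOn (parCylOpens 0 1) u G ∧
      ∃ ρ ∈ Ioc (0 : ℝ) 1, ∃ A₁ : ℝ≥0, ∀ r ∈ Ioc (0 : ℝ) ρ,
        energyA 0 r u + dissipationE 0 r G + cubicC 0 r u + pressureD 0 r p ≤ A₁) →
    (∃ ρ ∈ Ioc (0 : ℝ) 1, ∃ A₂ : ℝ,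
      ∀ᵐ z ∂(volume.restrict (parCyl 0 ρ)), cylRadius z.2 * ‖u z.1 z.2‖ ≤ A₂) →
    ¬ IsRegularAtOrigin u →
    ∃ w : ℝ → ℝ³ → ℝ³, IsBoundedWeakNSSolutionOn (Iio 0) isOpen_Iio 1 w ∧
      (∀ θ : ℝ, ∀ᵐ t ∂(volume.restrict (Iio (0 : ℝ))),
        (fun x => w t (rotZ θ x)) =ᵐ[volume] fun x => rotZ θ (w t x)) ∧
      (∃ A₂ : ℝ, ∀ᵐ t ∂(volume.restrict (Iio (0 : ℝ))), ∀ᵐ x ∂(volume : Measure ℝ³),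
        cylRadius x * ‖w t x‖ ≤ A₂) ∧
      ¬ (∀ᵐ t ∂(volume.restrict (Iio (0 : ℝ))), w t =ᵐ[volume] 0)

/-! ### Proved: the assembly of §4 -/

/-- **(r3) ⇒ (r2)**: the Type I bound `√(-t) ‖u‖ ≤ C` a.e. on `Q` gives `‖u‖ ≤ |C|/a` a.e. on
`Q ∩ {t < -a²}` for every `0 < a < 1` (elementary; this is how hypothesis (r2) of Lemma 3.3 /
Remark 3.4 is met under the hypotheses of Thm. 3.1 in §4).
[cite: SereginSverak2009, Thm. 3.1 (r3) and Thm. 3.2 (r2)] -/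
theorem isBoundedAwayFromZero_of_isTypeIOnCyl {u : ℝ → ℝ³ → ℝ³} (h : IsTypeIOnCyl u) :
    IsBoundedAwayFromZero u := by
  obtain ⟨C, hC⟩ := h
  intro a ha
  refine ⟨|C| / a, ?_⟩
  filter_upwards [hC] with z hz hza
  have hapos : 0 < a := ha.1
  have hsqrt : a < Real.sqrt (-z.1) := by
    rw [Real.lt_sqrt hapos.le]
    linarith
  have hspos : 0 < Real.sqrt (-z.1) := hapos.trans hsqrt
  rw [le_div_iff₀ hapos]
  calc ‖u z.1 z.2‖ * a ≤ ‖u z.1 z.2‖ * Real.sqrt (-z.1) :=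
        mul_le_mul_of_nonneg_left hsqrt.le (norm_nonneg _)
    _ = Real.sqrt (-z.1) * ‖u z.1 z.2‖ := mul_comm _ _
    _ ≤ C := hz
    _ ≤ |C| := le_abs_self C

/-- **Seregin–Šverák 2009, Theorem 3.1, assembled as in §4** (arXiv p. 11) from the named facts
`ScaledEnergyBound` (Lemma 3.5), `AxisDecayBound` (Prop. 3.7), `BlowupAlternative` (§4) and the
Liouville theorem `KNSS2009_liouville_bound_C_over_r` (KNSS 2009, Thm. 5.3): an axially
symmetric distributional solution in `Q` with `u ∈ L³(Q)`, `p ∈ L^{3/2}(Q)` and the Type I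
bound `|u| ≤ C/√(-t)` a.e. is regular at the origin. Proof as printed: Lemma 3.5 at `b = 0` gives
the local (p1) on `]0, 1/8]`, Prop. 3.7 gives the local (p2) on `Q(1/8)`, (r3) gives (r2); were
the origin singular, `BlowupAlternative` would produce a non-zero axisymmetric bounded ancient
weak solution with `|y'| |w| ≤ A₂`, which Thm. 5.3 of KNSS forces to vanish. (For the assembly
through the corrected blow-up step see `isRegularAtOrigin_of_typeI'` in
`SereginSverakBlowup.lean`; cf. the caveat on `BlowupAlternative`.)
[cite: SereginSverak2009, Thm. 3.1 and §4] -/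
theorem isRegularAtOrigin_of_typeI (h35 : ScaledEnergyBound) (h37 : AxisDecayBound)
    (h4 : BlowupAlternative) (h53 : KNSS2009_liouville_bound_C_over_r)
    {u : ℝ → ℝ³ → ℝ³} {p : ℝ → ℝ³ → ℝ} (hsol : IsAxisymmetricLocalSolution u p)
    (hI : IsTypeIOnCyl u) : IsRegularAtOrigin u := by
  by_contra hsing
  -- local (p1) from Lemma 3.5 at `z_b = 0`
  obtain ⟨G, hG, C₁, hC₁⟩ := h35 u p hsol hI
  have hp1 : ∃ G : ℝ → ℝ³ → ℝ³ →L[ℝ] ℝ³, HasWeakSpatialGradientOn (parCylOpens 0 1) u G ∧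
      ∃ ρ ∈ Ioc (0 : ℝ) 1, ∃ A₁ : ℝ≥0, ∀ r ∈ Ioc (0 : ℝ) ρ,
        energyA 0 r u + dissipationE 0 r G + cubicC 0 r u + pressureD 0 r p ≤ A₁ := by
    refine ⟨G, hG, 1 / 8, ⟨by norm_num, by norm_num⟩, C₁, fun r hr => ?_⟩
    have hr' : r ∈ Ioo (0 : ℝ) (1 / 4) := ⟨hr.1, by linarith [hr.2]⟩
    have key := hC₁ 0 (by norm_num) r hr'
    simpa only [zero_smul, Prod.mk_zero_zero] using key
  -- local (p2) from Proposition 3.7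
  have hp2 : ∃ ρ ∈ Ioc (0 : ℝ) 1, ∃ A₂ : ℝ,
      ∀ᵐ z ∂(volume.restrict (parCyl 0 ρ)), cylRadius z.2 * ‖u z.1 z.2‖ ≤ A₂ :=
    ⟨1 / 8, ⟨by norm_num, by norm_num⟩, h37 u p hsol hI⟩
  -- the blow-up limit, killed by KNSS 2009, Thm. 5.3
  obtain ⟨w, hw, haxi, hdecay, hne⟩ :=
    h4 u p hsol (isBoundedAwayFromZero_of_isTypeIOnCyl hI) hp1 hp2 hsing
  exact hne (h53 hw haxi hdecay)

end SereginSverak2009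

end Literature.Analysis.FluidPDE
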